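import Summits.NavierStokesRegularity.NavierStokesRegularity.Theorems.IsobarTomographyIsobaricLinesLiouvilleStubCovariance
import Summits.NavierStokesRegularity.NavierStokesRegularity.Theorems.IsobarTomographyIsobaricLinesLiouvilleStubTranslationLeaf
import Summits.NavierStokesRegularity.NavierStokesRegularity.Theorems.IsobarTomographyIsobaricLinesLiouvilleStubAxisymLeaf
import Summits.NavierStokesRegularity.NavierStokesRegularity.Theorems.IsobarTomographyIsobaricLinesLiouvilleIsometryTools
import Summits.NavierStokesRegularity.NavierStokesRegularity.Theses.IsobarTomography
import HarnessLib

/-!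
# Symmetric Liouville theorems for the bounded ancient class, coordinate-free
# — crux `IsobaricLinesLiouville` (stmt-NavierStokesRegularity-11741), line `Ideator2Sketch`

Lead file (supports the crux). From the landed stubs `stub_covariance` (rigid motions act on the
class), `stub_translationLeaf` (vorticity along `e₁` ⟹ slice-constant; KNSS Thm 5.1) and
`stub_axisymLeaf` (infinitesimal axisymmetry about the `x₃`-axis without swirl ⟹ slice-constant;
KNSS Thm 5.2) and the isometry tools (`exists_isometry_map_eq`, `curl_conj_isometry`,
`cross_map_isometry`, `sliceConst_of_conj`):

* `sliceConst_of_curl_parallel` — a bounded ancient mild solution (`ν = 1`), classical on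
  `(-∞,0)`, whose vorticity is everywhere parallel to ONE fixed vector at every `t < 0`, is constant
  on every slice;
* `sliceConst_of_axisym` — the same conclusion for a solution infinitesimally invariant under the
  rotations about ONE fixed axis (any direction `e ≠ 0`, any point `c`) with no swirl about it.
Sources: Koch–Nadirashvili–Seregin–Šverák 2009 (arXiv:0709.3599) Thms 5.1–5.2; elementary
covariance of the Navier–Stokes system (Majda–Bertozzi §1.2).
-/

noncomputable section

-- the summit and its single problem share the name (D-0017 nested layout)
set_option linter.dupNamespace false

namespace Summit.NavierStokesRegularity.NavierStokesRegularity.Theorems.IsobaricLinesLiouville.FluxSurfacePersistence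

open scoped InnerProductSpace RealInnerProductSpace Topology ContDiff Laplacian
open Literature.Analysis.FluidPDE Set Filter MeasureTheory Function WithLp
open Summit.NavierStokesRegularity.NavierStokesRegularity.Theses.IsobarTomography

/-! ### Symmetric Liouville theorems for arbitrary directions / axes -/

/-- **Liouville for bounded ancient solutions with unidirectional vorticity.** A bounded ancient
mild solution (`ν = 1`), classical on `(-∞,0)`, whose vorticity is everywhere parallel to ONE
fixed vector `a` at every `t < 0`, is constant on every slice: rotate `a` onto `‖a‖ e₁`
(`exists_isometry_map_eq`), conjugate (`stub_covariance`; the conjugated vorticity is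
`det R • R (μ a) ∥ e₁` by `curl_conj_isometry`) and apply the planar leaf
(`stub_translationLeaf`, KNSS Thm 5.1). For `a = 0` the hypothesis says `ω ≡ 0`. -/
theorem sliceConst_of_curl_parallel :
    ∀ (v : ℝ → (EuclideanSpace ℝ (Fin 3)) → (EuclideanSpace ℝ (Fin 3)))
      (q : ℝ → (EuclideanSpace ℝ (Fin 3)) → ℝ),
      IsBoundedAncientMildSolution 1 v → IsClassicalNSSolutionOn (Set.Iio 0) 1 0 v q →
        ∀ (a : EuclideanSpace ℝ (Fin 3)),
          (∀ t < 0, ∀ x : EuclideanSpace ℝ (Fin 3), ∃ μ : ℝ, curl (v t) x = μ • a) →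
            ∀ t < 0, ∃ b : EuclideanSpace ℝ (Fin 3), v t = fun _ => b := by
  intro v q hanc hcl a hpar
  obtain ⟨R, hR⟩ := exists_isometry_map_eq a (EuclideanSpace.single 1 (1 : ℝ)) (by simp)
  obtain ⟨ε, -, -, hcurlR⟩ := curl_conj_isometry R
  obtain ⟨hanc', hcl'⟩ := stub_covariance v q R 0 hanc hcl
  refine sliceConst_of_conj v R 0 (stub_translationLeaf _ _ hanc' hcl' fun t ht y => ?_)
  have hdiff : DifferentiableAt ℝ (v t) (R.symm y + 0) :=
    ((hcl.contDiff_velocity ht).differentiable (by simp)).differentiableAt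
  have hcurl := hcurlR 0 (v t) y hdiff
  obtain ⟨μ, hμ⟩ := hpar t ht (R.symm y + 0)
  have hform : curl (fun z => R (v t (R.symm z + 0))) y =
      (ε * μ * ‖a‖) • EuclideanSpace.single 1 (1 : ℝ) := by
    rw [hcurl, hμ, map_smul, hR, smul_smul, smul_smul]
  refine ⟨?_, ?_⟩ <;> rw [hform] <;> simp

/-- **Liouville for bounded ancient solutions axisymmetric without swirl about an arbitrary
axis.** A bounded ancient mild solution (`ν = 1`), classical on `(-∞,0)`, which at every `t < 0`
is infinitesimally invariant under the rotations about the axis through `c` with direction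
`e ≠ 0` (`Dv(x)[e × (x − c)] = e × v(x)`) and has no swirl about it (`⟪v, e × (x − c)⟫ = 0`) is
constant on every slice: move the axis onto the `x₃`-axis (`exists_isometry_map_eq`,
`stub_covariance`; the Killing data transform by `cross_map_isometry`, the sign `det R`
cancelling) and apply the axisymmetric leaf (`stub_axisymLeaf`, KNSS Thm 5.2). -/
theorem sliceConst_of_axisym (v : ℝ → (EuclideanSpace ℝ (Fin 3)) → (EuclideanSpace ℝ (Fin 3))) (q : ℝ → (EuclideanSpace ℝ (Fin 3)) → ℝ)
    (hanc : IsBoundedAncientMildSolution 1 v) (hcl : IsClassicalNSSolutionOn (Set.Iio 0) 1 0 v q)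
    (e c : (EuclideanSpace ℝ (Fin 3))) (he : e ≠ 0)
    (hkill : ∀ t < 0, ∀ x : (EuclideanSpace ℝ (Fin 3)), fderiv ℝ (v t) x (cross e (x - c)) = cross e (v t x))
    (hswirl : ∀ t < 0, ∀ x : (EuclideanSpace ℝ (Fin 3)), ⟪v t x, cross e (x - c)⟫_ℝ = 0) :
    ∀ t < 0, ∃ b : (EuclideanSpace ℝ (Fin 3)), v t = fun _ => b := by
  have heZ : ‖(eZ : (EuclideanSpace ℝ (Fin 3)))‖ = 1 := by simp [eZ]
  obtain ⟨R, hR⟩ := exists_isometry_map_eq e eZ heZ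
  obtain ⟨ε, -, hcross⟩ := cross_map_isometry R
  obtain ⟨hanc', hcl'⟩ := stub_covariance v q R c hanc hcl
  have hne : ‖e‖ ≠ 0 := norm_ne_zero_iff.2 he
  have heZ' : (eZ : (EuclideanSpace ℝ (Fin 3))) = ‖e‖⁻¹ • R e := by
    rw [hR, smul_smul, inv_mul_cancel₀ hne, one_smul]
  have hcr : ∀ y : (EuclideanSpace ℝ (Fin 3)), cross eZ y = (‖e‖⁻¹ * ε) • R (cross e (R.symm y)) := by
    intro y
    conv_lhs => rw [heZ', ← R.apply_symm_apply y]
    rw [cross_smul_left', hcross, smul_smul]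
  refine sliceConst_of_conj v R c (stub_axisymLeaf _ _ hanc' hcl' (fun t ht y => ?_) (fun t ht y => ?_))
  · set x := R.symm y + c with hx
    have hxc : R.symm y = x - c := by rw [hx, add_sub_cancel_right]
    have hdiff : DifferentiableAt ℝ (v t) x :=
      ((hcl.contDiff_velocity ht).differentiable (by simp)).differentiableAt
    have hA : HasFDerivAt (fun z : (EuclideanSpace ℝ (Fin 3)) => R.symm z + c) (R.symm : (EuclideanSpace ℝ (Fin 3)) →L[ℝ] (EuclideanSpace ℝ (Fin 3))) y :=
      (R.symm : (EuclideanSpace ℝ (Fin 3)) →L[ℝ] (EuclideanSpace ℝ (Fin 3))).hasFDerivAt.add_const c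
    have hcomp : HasFDerivAt (fun z => R (v t (R.symm z + c)))
        ((R : (EuclideanSpace ℝ (Fin 3)) →L[ℝ] (EuclideanSpace ℝ (Fin 3))).comp ((fderiv ℝ (v t) x).comp (R.symm : (EuclideanSpace ℝ (Fin 3)) →L[ℝ] (EuclideanSpace ℝ (Fin 3))))) y :=
      (R : (EuclideanSpace ℝ (Fin 3)) →L[ℝ] (EuclideanSpace ℝ (Fin 3))).hasFDerivAt.comp y (hdiff.hasFDerivAt.comp y hA)
    rw [hcomp.fderiv, hcr y]
    simp only [ContinuousLinearMap.coe_comp, Function.comp_apply, map_smul]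
    change _ • R (fderiv ℝ (v t) x (R.symm (R (cross e (R.symm y))))) = _
    rw [LinearIsometryEquiv.symm_apply_apply, hxc, hkill t ht x]
    conv_rhs => rw [heZ', cross_smul_left', hcross, smul_smul]
  · have hs := hswirl t ht (R.symm y + c)
    rw [add_sub_cancel_right] at hs
    rw [hcr y, inner_smul_right, LinearIsometryEquiv.inner_map_map, hs, mul_zero]


end Summit.NavierStokesRegularity.NavierStokesRegularity.Theorems.IsobaricLinesLiouville.FluxSurfacePersistence

end
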